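import Summits.CriticalPhenomena.PercolationContinuityZ3.Theorems.PercNearOneGluingNoHeavyLowerTailAntitheticSeriesFar
import HarnessLib

/-!
# `NoHeavyLowerTail` (stmt-CriticalPhenomena-4575) — antithetic cluster pairs: **SERIES COMPOSITION AT THE DUAL LEVEL, CERTIFIED NEAR
# SIDE** (THEOREM S½, near half: ⊕-positivity of `K₁ ∪_c K₂` from red-dominated BOXES of `(K₁, s, c)` and DUAL ⊕-positivity of
# `(K₂, c, P)`; prim-hp-2 gen 65, HOME/MEMO-gen65.md §1)

Support file (`--supports stmt-CriticalPhenomena-4575`, hull-port prover `prim-hp-2`, gen 65).  No definitions, no named facts, no sorries;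
standard axioms.  Notation and setting of …AntitheticSeriesFar: `E₁ ∋ s` (near) and `E₂` (far) disjoint, glued at `c`;
`X₁, Y₁` = clusters of `s` in `E₁`, `A, B` = clusters of `c` in `E₂`; the clusters of `E₁ ∪ E₂` are the conditional lifts
`X = X₁ ∪ {u | c ∈ X₁ ∧ u ∈ A}`, `Y = Y₁ ∪ {u | c ∈ Y₁ ∧ u ∈ B}`; 𝒮 = twisted-monotone super-odd test functions.

This is the mirror image of …AntitheticSeriesFar: now the NEAR event is partitioned into boxes red-dominated for the clusters of `s` in
`E₁` and the FAR side carries only a DUAL hypothesis.  For a fixed far colouring the near box `S ↦ (X₁ S, Y₁ S)` acts on the far pair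
`(A, B)` by the lift maps `Φ_S A' = X₁ S ∪ {u | c ∈ X₁ S ∧ u ∈ A'}` (monotone in `S` and in `A'`) and `Ψ_S B' = Y₁ S ∪ {u | c ∈ Y₁ S ∧ u ∈ B'}`
(antitone in `S`), and `Ψ_{Sᶜ} A' ⊆ Φ_S A'` is exactly the red domination `Y₁ Sᶜ ⊆ X₁ S` of the near box; so
`Antithetic.lift_composition_filter_nonneg` applies with the two sides exchanged (Harris in the near box for each far colouring, then the
far dual hypothesis for the box-averaged test functions).
* `Antithetic.Series.event_sum_nonneg_of_near_boxes` — GENERIC FORM: `pred₁` determined by `ω ∩ E₁` and partitioned into boxes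
  red-dominated for `(E₁, s)`; `pred₂` determined by `ω ∩ E₂` with `Σ_{pred₂} K₁K₂(A, B) ≥ 0` for all `K ∈ 𝒮` (clusters of `c` in `E₂`);
  then `Σ_{pred₁ ∧ pred₂} K₁K₂(X, Y) ≥ 0` for all `K₁, K₂ ∈ 𝒮`.
* `Antithetic.Series.oplus_nonneg_of_near_boxes` — **THEOREM S½ (near half)**: ⊕-boxes of `(E₁, s, c)` (the output of `Cyc.ear_boxes`,
  `Box.boxes_series`, `Box.boxes_hang`, …) and DUAL ⊕-positivity of `(E₂, c, P)` ⇒ `(E₁ ∪ E₂, s, P)` ⊕-positive.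
With …AntitheticSeriesFar: CONJECTURE S (series preserves ⊕ at the dual level, HOME/MEMO-gen64.md §5 (P1)) holds as soon as ONE of the two
factors is box-certified; what remains open is the composition of two factors that are ⊕-positive WITHOUT red-dominated certificates.
REMARK (the mixed sum).  With near boxes the mixed sum (M) at `(P, Q)`, `Q` on the far side, would need the near boxes to be `c`-PURE
(`c ∈ Y₁` constant on each box: the composite event `{Q ∉ Y} = ¬(c ∈ Y₁ ∧ Q ∈ B)` must be constant along the box for Harris); cycle boxes
are not pure, so that statement is not recorded here — the COMPARABLE near side (…AntitheticSeriesComparable) is pure automatically.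
[cite: VandenbergHaggstromKahn2005, §1 p. 6 ("Harris' inequality"), §1 p. 3 (open cluster `C_s`)]
-/

noncomputable section

namespace Summit.CriticalPhenomena.PercolationContinuityZ3.Theorems

open Literature.Probability.Percolation
open scoped Classical

namespace Antithetic

namespace Series

variable {V : Type*} [Fintype V] {E₁ E₂ : Set (Sym2 V)} {s c : V}
  (hsep : ∀ e₁ ∈ E₁, ∀ e₂ ∈ E₂, ∀ v : V, v ∈ e₁ → v ∈ e₂ → v = c) (hs : ∀ e ∈ E₂, s ∈ e → s = c)
include hsep hs

/-- **Series composition, certified near side (generic event form).**  `E₁, E₂` disjoint, glued at `c`, source `s` on the near side.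
NEAR: an event `pred₁` determined by `ω ∩ E₁`, partitioned into boxes `(Fix b, N b)` (cover / inside / uniqueness) red-dominated for the
clusters of `s` in `E₁`.  FAR: an event `pred₂` determined by `ω ∩ E₂` with `Σ_{pred₂} K₁K₂(A, B) ≥ 0` for all `K₁, K₂ ∈ 𝒮`, `A, B` the
clusters of `c` in `E₂`.  Then `Σ_{ω : pred₁ ω ∧ pred₂ ω} K₁K₂(X_{E₁∪E₂} ω, Y_{E₁∪E₂} ω) ≥ 0` for all twisted-monotone super-odd `K₁, K₂`.
[this work] -/
theorem event_sum_nonneg_of_near_boxes (hdis : Disjoint E₁ E₂) (pred₁ : Set (Sym2 V) → Prop) [DecidablePred pred₁]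
    (hpred₁ : ∀ ω ω' : Set (Sym2 V), ω ∩ E₁ = ω' ∩ E₁ → (pred₁ ω ↔ pred₁ ω'))
    {C : Type*} (Fix N : C → Set (Sym2 V))
    (hcover : ∀ T : Set (Sym2 V), pred₁ T → ∃ b, ∀ e ∈ Fix b, (e ∈ T ↔ e ∈ N b))
    (hinside : ∀ b (T : Set (Sym2 V)), (∀ e ∈ Fix b, (e ∈ T ↔ e ∈ N b)) → pred₁ T)
    (huniq : ∀ b b' (T : Set (Sym2 V)), (∀ e ∈ Fix b, (e ∈ T ↔ e ∈ N b)) → (∀ e ∈ Fix b', (e ∈ T ↔ e ∈ N b')) → b = b')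
    (hdom : ∀ b (T T' : Set (Sym2 V)), (∀ e ∈ Fix b, (e ∈ T ↔ e ∈ N b)) → (∀ e ∈ Fix b, (e ∈ T' ↔ e ∈ N b)) →
      (∀ e ∉ Fix b, (e ∈ T' ↔ e ∉ T)) → openCluster (T'ᶜ ∩ E₁) s ⊆ openCluster (T ∩ E₁) s)
    (pred₂ : Set (Sym2 V) → Prop) [DecidablePred pred₂]
    (hpred₂ : ∀ ω ω' : Set (Sym2 V), ω ∩ E₂ = ω' ∩ E₂ → (pred₂ ω ↔ pred₂ ω'))
    (hplus : ∀ K₁ K₂ : Set V → Set V → ℝ,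
      (∀ ⦃P P' Q Q' : Set V⦄, P ⊆ P' → Q' ⊆ Q → K₁ P Q ≤ K₁ P' Q') → (∀ P Q, 0 ≤ K₁ P Q + K₁ Q P) →
      (∀ ⦃P P' Q Q' : Set V⦄, P ⊆ P' → Q' ⊆ Q → K₂ P Q ≤ K₂ P' Q') → (∀ P Q, 0 ≤ K₂ P Q + K₂ Q P) →
      0 ≤ ∑ ω ∈ Finset.univ.filter (fun ω : Set (Sym2 V) => pred₂ ω),
        K₁ (openCluster (ω ∩ E₂) c) (openCluster (ωᶜ ∩ E₂) c) * K₂ (openCluster (ω ∩ E₂) c) (openCluster (ωᶜ ∩ E₂) c))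
    (K₁ K₂ : Set V → Set V → ℝ)
    (hK₁ : ∀ ⦃P P' Q Q' : Set V⦄, P ⊆ P' → Q' ⊆ Q → K₁ P Q ≤ K₁ P' Q') (hso₁ : ∀ P Q, 0 ≤ K₁ P Q + K₁ Q P)
    (hK₂ : ∀ ⦃P P' Q Q' : Set V⦄, P ⊆ P' → Q' ⊆ Q → K₂ P Q ≤ K₂ P' Q') (hso₂ : ∀ P Q, 0 ≤ K₂ P Q + K₂ Q P) :
    0 ≤ ∑ ω ∈ Finset.univ.filter (fun ω : Set (Sym2 V) => pred₁ ω ∧ pred₂ ω),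
      K₁ (openCluster (ω ∩ (E₁ ∪ E₂)) s) (openCluster (ωᶜ ∩ (E₁ ∪ E₂)) s) *
        K₂ (openCluster (ω ∩ (E₁ ∪ E₂)) s) (openCluster (ωᶜ ∩ (E₁ ∪ E₂)) s) := by
  -- notation
  let X₁ : Set (Sym2 V) → Set V := fun ω => openCluster (ω ∩ E₁) s
  let Y₁ : Set (Sym2 V) → Set V := fun ω => openCluster (ωᶜ ∩ E₁) s
  let A : Set (Sym2 V) → Set V := fun ω => openCluster (ω ∩ E₂) c
  let B : Set (Sym2 V) → Set V := fun ω => openCluster (ωᶜ ∩ E₂) c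
  let L : Set V → Set V → Set V := fun P S => P ∪ {u | c ∈ P ∧ u ∈ S}
  let KK : Set V → Set V → ℝ := fun P Q => K₁ P Q * K₂ P Q
  let mem : C → Set (Sym2 V) → Prop := fun b T => ∀ e ∈ Fix b, (e ∈ T ↔ e ∈ N b)
  let Ψ₂ : Set (Sym2 V) → Set (Sym2 V) → ℝ := fun ω₁ ω₂ =>
    if pred₁ ω₁ ∧ pred₂ ω₂ then KK (L (X₁ ω₁) (A ω₂)) (L (Y₁ ω₁) (B ω₂)) else 0
  have hdis' : ∀ e, e ∈ E₁ → e ∉ E₂ := fun e h1 h2 => Set.disjoint_left.1 hdis h1 h2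
  -- (1) the target is the diagonal of `Ψ₂`
  have hdiag : ∑ ω ∈ Finset.univ.filter (fun ω : Set (Sym2 V) => pred₁ ω ∧ pred₂ ω),
      K₁ (openCluster (ω ∩ (E₁ ∪ E₂)) s) (openCluster (ωᶜ ∩ (E₁ ∪ E₂)) s) *
        K₂ (openCluster (ω ∩ (E₁ ∪ E₂)) s) (openCluster (ωᶜ ∩ (E₁ ∪ E₂)) s) = ∑ ω, Ψ₂ ω ω := by
    rw [Finset.sum_filter]
    refine Finset.sum_congr rfl fun ω _ => ?_
    have e1 : openCluster (ω ∩ (E₁ ∪ E₂)) s = L (X₁ ω) (A ω) := OneSum.cluster_eq hsep hs ω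
    have e2 : openCluster (ωᶜ ∩ (E₁ ∪ E₂)) s = L (Y₁ ω) (B ω) := OneSum.cluster_eq hsep hs ωᶜ
    rw [e1, e2]
  -- (2) grafting: the double sum is `|Set (Sym2 V)|` times the diagonal
  let θ : Set (Sym2 V) × Set (Sym2 V) → Set (Sym2 V) × Set (Sym2 V) :=
    fun p => ((p.1 \ E₂) ∪ (p.2 ∩ E₂), (p.2 \ E₂) ∪ (p.1 ∩ E₂))
  have hθ : Function.Involutive θ := fun p => Cut.graft_graft E₂ p
  have g1 : ∀ a b : Set (Sym2 V), ((a \ E₂) ∪ (b ∩ E₂)) ∩ E₁ = a ∩ E₁ := by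
    intro a b; ext e
    simp only [Set.mem_inter_iff, Set.mem_union, Set.mem_sdiff]
    constructor
    · rintro ⟨h | h, he⟩
      · exact ⟨h.1, he⟩
      · exact absurd h.2 (hdis' e he)
    · rintro ⟨hc, he⟩; exact ⟨Or.inl ⟨hc, hdis' e he⟩, he⟩
  have g2 : ∀ a b : Set (Sym2 V), ((a \ E₂) ∪ (b ∩ E₂))ᶜ ∩ E₁ = aᶜ ∩ E₁ := by
    intro a b; ext e
    simp only [Set.mem_inter_iff, Set.mem_compl_iff, Set.mem_union, Set.mem_sdiff, not_or, not_and, not_not]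
    constructor
    · rintro ⟨⟨h1, _⟩, he⟩; exact ⟨fun hc => hdis' e he (h1 hc), he⟩
    · rintro ⟨hc, he⟩; exact ⟨⟨fun hc' => absurd hc' hc, fun _ he2 => absurd he2 (hdis' e he)⟩, he⟩
  have hΨθ : ∀ p : Set (Sym2 V) × Set (Sym2 V), Ψ₂ p.1 p.2 = Ψ₂ (θ p).1 (θ p).1 := by
    intro p
    have a0 : pred₁ (θ p).1 ↔ pred₁ p.1 := hpred₁ _ _ (g1 p.1 p.2)
    have a0' : pred₂ (θ p).1 ↔ pred₂ p.2 := hpred₂ _ _ (Cut.graft_inter_right p.1 p.2).1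
    have a1 : X₁ (θ p).1 = X₁ p.1 := by show openCluster (((p.1 \ E₂) ∪ (p.2 ∩ E₂)) ∩ E₁) s = _; rw [g1]
    have a2 : Y₁ (θ p).1 = Y₁ p.1 := by show openCluster (((p.1 \ E₂) ∪ (p.2 ∩ E₂))ᶜ ∩ E₁) s = _; rw [g2]
    have a3 : A (θ p).1 = A p.2 := by
      show openCluster (((p.1 \ E₂) ∪ (p.2 ∩ E₂)) ∩ E₂) c = _; rw [(Cut.graft_inter_right p.1 p.2).1]
    have a4 : B (θ p).1 = B p.2 := by
      show openCluster (((p.1 \ E₂) ∪ (p.2 ∩ E₂))ᶜ ∩ E₂) c = _; rw [(Cut.graft_inter_right p.1 p.2).2]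
    simp only [Ψ₂, a0, a0', a1, a2, a3, a4]
  have hrel : ∑ ω₁, ∑ ω₂, Ψ₂ ω₁ ω₂ = (Fintype.card (Set (Sym2 V)) : ℝ) * ∑ ω, Ψ₂ ω ω := by
    rw [← Fintype.sum_prod_type']
    rw [show ∑ p : Set (Sym2 V) × Set (Sym2 V), Ψ₂ p.1 p.2 = ∑ p : Set (Sym2 V) × Set (Sym2 V), Ψ₂ (θ p).1 (θ p).1 from
      Fintype.sum_congr _ _ hΨθ]
    rw [Fintype.sum_bijective θ hθ.bijective (fun p => Ψ₂ (θ p).1 (θ p).1) (fun q => Ψ₂ q.1 q.1) (fun p => rfl)]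
    rw [Fintype.sum_prod_type, Finset.mul_sum]
    refine Finset.sum_congr rfl fun a _ => ?_
    show ∑ _d : Set (Sym2 V), Ψ₂ a a = _
    rw [Finset.sum_const, Finset.card_univ, nsmul_eq_mul]
  -- (3) for each near box, the far sum of the box sums is nonnegative (lift composition over the near box)
  let Φ : Set (Sym2 V) → ℝ := fun ω₁ =>
    ∑ ω₂ ∈ Finset.univ.filter (fun ω : Set (Sym2 V) => pred₂ ω), KK (L (X₁ ω₁) (A ω₂)) (L (Y₁ ω₁) (B ω₂))
  have hpart : ∀ b : C, 0 ≤ ∑ M ∈ Finset.univ.filter (fun M : Set (Sym2 V) => mem b M), Φ M := by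
    intro b
    -- parametrise the box by its free pairs
    let ι := {e : Sym2 V // e ∉ Fix b}
    let emb : Set ι → Set (Sym2 V) := fun S => (N b ∩ Fix b) ∪ {e | ∃ h : e ∉ Fix b, (⟨e, h⟩ : ι) ∈ S}
    let proj : Set (Sym2 V) → Set ι := fun T => {p | p.1 ∈ T}
    have hemb_mono : Monotone emb := by
      intro S S' h e he
      rcases he with he | ⟨hne, hmem⟩
      · exact Or.inl he
      · exact Or.inr ⟨hne, h hmem⟩
    have hemb_mem : ∀ S, mem b (emb S) := by
      intro S e he
      constructor
      · rintro (h | ⟨hne, _⟩)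
        · exact h.1
        · exact absurd he hne
      · exact fun h => Or.inl ⟨h, he⟩
    have hemb_off : ∀ S (e : Sym2 V) (h : e ∉ Fix b), e ∈ emb S ↔ (⟨e, h⟩ : ι) ∈ S := by
      intro S e h
      constructor
      · rintro (h' | ⟨_, h'⟩)
        · exact absurd h'.2 h
        · exact h'
      · exact fun h' => Or.inr ⟨h, h'⟩
    have hbij : ∀ f : Set (Sym2 V) → ℝ,
        ∑ S : Set ι, f (emb S) = ∑ T ∈ Finset.univ.filter (fun M : Set (Sym2 V) => mem b M), f T := by
      intro f
      refine Finset.sum_nbij' emb proj ?_ ?_ ?_ ?_ ?_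
      · intro S _
        exact Finset.mem_filter.2 ⟨Finset.mem_univ _, hemb_mem S⟩
      · intro T _; exact Finset.mem_univ _
      · intro S _
        ext p
        simp only [proj, Set.mem_setOf_eq]
        exact hemb_off S p.1 p.2
      · intro T hT
        have hT' : mem b T := (Finset.mem_filter.1 hT).2
        ext e
        by_cases he : e ∈ Fix b
        · rw [hT' e he]
          constructor
          · rintro (h | ⟨hne, _⟩)
            · exact h.1
            · exact absurd he hne
          · exact fun h => Or.inl ⟨h, he⟩
        · rw [hemb_off (proj T) e he]
          rfl
      · intro S _; rfl
    -- red domination of the parametrised near box (clusters of `s` in `E₁`)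
    have hdom' : ∀ S : Set ι, Y₁ (emb Sᶜ) ⊆ X₁ (emb S) := by
      intro S
      refine hdom b (emb S) (emb Sᶜ) (hemb_mem S) (hemb_mem Sᶜ) fun e he => ?_
      rw [hemb_off Sᶜ e he, hemb_off S e he, Set.mem_compl_iff]
    -- exchange the two sums and parametrise
    have hx : ∑ M ∈ Finset.univ.filter (fun M : Set (Sym2 V) => mem b M), Φ M =
        ∑ ω₂ ∈ Finset.univ.filter (fun ω : Set (Sym2 V) => pred₂ ω), ∑ S : Set ι,
          KK (L (X₁ (emb S)) (A ω₂)) (L (Y₁ (emb S)) (B ω₂)) := by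
      show (∑ M ∈ Finset.univ.filter (fun M : Set (Sym2 V) => mem b M),
          ∑ ω₂ ∈ Finset.univ.filter (fun ω : Set (Sym2 V) => pred₂ ω), KK (L (X₁ M) (A ω₂)) (L (Y₁ M) (B ω₂))) = _
      rw [Finset.sum_comm]
      refine Finset.sum_congr rfl fun ω₂ _ => ?_
      exact (hbij (fun M => KK (L (X₁ M) (A ω₂)) (L (Y₁ M) (B ω₂)))).symm
    rw [hx]
    refine lift_composition_filter_nonneg pred₂ A B hplus (fun S A' => L (X₁ (emb S)) A') (fun S B' => L (Y₁ (emb S)) B')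
      ?_ ?_ ?_ ?_ ?_ hK₁ hso₁ hK₂ hso₂
    · -- monotone in the far set
      intro S A' A'' hA u hu
      rcases hu with hu | ⟨hc, hu⟩
      · exact Or.inl hu
      · exact Or.inr ⟨hc, hA hu⟩
    · intro S B' B'' hB u hu
      rcases hu with hu | ⟨hc, hu⟩
      · exact Or.inl hu
      · exact Or.inr ⟨hc, hB hu⟩
    · -- `Φ` monotone in `S` (the near box coordinate)
      intro A' S S' hSS' u hu
      have hX : X₁ (emb S) ⊆ X₁ (emb S') := Freeze.openCluster_mono (Set.inter_subset_inter_left E₁ (hemb_mono hSS')) s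
      rcases hu with hu | ⟨hc, hu⟩
      · exact Or.inl (hX hu)
      · exact Or.inr ⟨hX hc, hu⟩
    · -- `Ψ` antitone in `S`
      intro B' S S' hSS' u hu
      have hY : Y₁ (emb S') ⊆ Y₁ (emb S) := Freeze.openCluster_mono
        (Set.inter_subset_inter_left E₁ (Set.compl_subset_compl.2 (hemb_mono hSS'))) s
      rcases hu with hu | ⟨hc, hu⟩
      · exact Or.inl (hY hu)
      · exact Or.inr ⟨hY hc, hu⟩
    · -- antipodal domination = red domination of the near box
      intro S A' u hu
      rcases hu with hu | ⟨hc, hu⟩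
      · exact Or.inl (hdom' S hu)
      · exact Or.inr ⟨hdom' S hc, hu⟩
  -- (4) the double sum is nonnegative: sum over near boxes (parts) of (3)
  have hdbl : 0 ≤ ∑ ω₁, ∑ ω₂, Ψ₂ ω₁ ω₂ := by
    have hΦ : ∀ ω₁, ∑ ω₂, Ψ₂ ω₁ ω₂ = if pred₁ ω₁ then Φ ω₁ else 0 := by
      intro ω₁
      by_cases h : pred₁ ω₁
      · simp only [Ψ₂, h, true_and, if_true]
        show (∑ ω₂, if pred₂ ω₂ then KK (L (X₁ ω₁) (A ω₂)) (L (Y₁ ω₁) (B ω₂)) else 0) = _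
        rw [← Finset.sum_filter]
      · simp only [Ψ₂, h, false_and, if_false, Finset.sum_const_zero]
    simp_rw [hΦ]
    rw [← Finset.sum_filter]
    -- parts = near boxes
    let D : Finset (Set (Sym2 V)) := Finset.univ.filter (fun ω : Set (Sym2 V) => pred₁ ω)
    let Pt : Set (Sym2 V) → Finset (Set (Sym2 V)) := fun T =>
      if h : pred₁ T then Finset.univ.filter (fun M => mem (Classical.choose (hcover T h)) M) else ∅
    have hPt : ∀ T ∈ D, ∃ b, mem b T ∧ Pt T = Finset.univ.filter (fun M => mem b M) := by
      intro T hT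
      have h : pred₁ T := (Finset.mem_filter.1 hT).2
      refine ⟨Classical.choose (hcover T h), Classical.choose_spec (hcover T h), ?_⟩
      simp only [Pt, dif_pos h]
    refine sum_nonneg_of_parts D Φ Pt ?_ ?_ ?_ ?_
    · intro T hT
      obtain ⟨b, hmem, hPT⟩ := hPt T hT
      rw [hPT]
      exact Finset.mem_filter.2 ⟨Finset.mem_univ _, hmem⟩
    · intro T hT M hM
      obtain ⟨b, -, hPT⟩ := hPt T hT
      rw [hPT] at hM
      exact Finset.mem_filter.2 ⟨Finset.mem_univ _, hinside b M (Finset.mem_filter.1 hM).2⟩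
    · intro T hT M hM
      obtain ⟨b, -, hPT⟩ := hPt T hT
      rw [hPT] at hM
      have hMb : mem b M := (Finset.mem_filter.1 hM).2
      have hMD : M ∈ D := Finset.mem_filter.2 ⟨Finset.mem_univ _, hinside b M hMb⟩
      obtain ⟨b', hMb', hPM⟩ := hPt M hMD
      rw [hPM, hPT, huniq b' b M hMb' hMb]
    · intro T hT
      obtain ⟨b, -, hPT⟩ := hPt T hT
      rw [hPT]
      exact hpart b
  -- (5) conclude
  rw [hdiag]
  have hN : (0 : ℝ) < (Fintype.card (Set (Sym2 V)) : ℝ) := by exact_mod_cast Fintype.card_pos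
  rw [hrel] at hdbl
  exact (mul_nonneg_iff_of_pos_left hN).1 hdbl

/-- **THEOREM S½ (near half): series composition preserves ⊕-positivity when the near factor is box-certified.**  `E₁, E₂` disjoint,
glued at `c`, `s` on the near side, `P ≠ s` on the far side.  If the ⊕-event `{c ∈ openCluster (T ∩ E₁) s}` is partitioned into
red-dominated boxes and `(E₂, c, P)` is ⊕-positive — `Σ_{P ∈ A} K₁K₂(A, B) ≥ 0` for all `K₁, K₂ ∈ 𝒮`, clusters of `c` in `E₂` — then
`(E₁ ∪ E₂, s, P)` is ⊕-positive. [this work] -/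
theorem oplus_nonneg_of_near_boxes (hdis : Disjoint E₁ E₂) {P : V} (hPs : P ≠ s) (hPE : ∀ e ∈ E₁, P ∈ e → P = c)
    {C : Type*} (Fix N : C → Set (Sym2 V))
    (hcover : ∀ T : Set (Sym2 V), c ∈ openCluster (T ∩ E₁) s → ∃ b, ∀ e ∈ Fix b, (e ∈ T ↔ e ∈ N b))
    (hinside : ∀ b (T : Set (Sym2 V)), (∀ e ∈ Fix b, (e ∈ T ↔ e ∈ N b)) → c ∈ openCluster (T ∩ E₁) s)
    (huniq : ∀ b b' (T : Set (Sym2 V)), (∀ e ∈ Fix b, (e ∈ T ↔ e ∈ N b)) → (∀ e ∈ Fix b', (e ∈ T ↔ e ∈ N b')) → b = b')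
    (hdom : ∀ b (T T' : Set (Sym2 V)), (∀ e ∈ Fix b, (e ∈ T ↔ e ∈ N b)) → (∀ e ∈ Fix b, (e ∈ T' ↔ e ∈ N b)) →
      (∀ e ∉ Fix b, (e ∈ T' ↔ e ∉ T)) → openCluster (T'ᶜ ∩ E₁) s ⊆ openCluster (T ∩ E₁) s)
    (hplus : ∀ K₁ K₂ : Set V → Set V → ℝ,
      (∀ ⦃A A' B B' : Set V⦄, A ⊆ A' → B' ⊆ B → K₁ A B ≤ K₁ A' B') → (∀ A B, 0 ≤ K₁ A B + K₁ B A) →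
      (∀ ⦃A A' B B' : Set V⦄, A ⊆ A' → B' ⊆ B → K₂ A B ≤ K₂ A' B') → (∀ A B, 0 ≤ K₂ A B + K₂ B A) →
      0 ≤ ∑ ω ∈ Finset.univ.filter (fun ω : Set (Sym2 V) => P ∈ openCluster (ω ∩ E₂) c),
        K₁ (openCluster (ω ∩ E₂) c) (openCluster (ωᶜ ∩ E₂) c) * K₂ (openCluster (ω ∩ E₂) c) (openCluster (ωᶜ ∩ E₂) c))
    (K₁ K₂ : Set V → Set V → ℝ)
    (hK₁ : ∀ ⦃A A' B B' : Set V⦄, A ⊆ A' → B' ⊆ B → K₁ A B ≤ K₁ A' B') (hso₁ : ∀ A B, 0 ≤ K₁ A B + K₁ B A)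
    (hK₂ : ∀ ⦃A A' B B' : Set V⦄, A ⊆ A' → B' ⊆ B → K₂ A B ≤ K₂ A' B') (hso₂ : ∀ A B, 0 ≤ K₂ A B + K₂ B A) :
    0 ≤ ∑ ω ∈ Finset.univ.filter (fun ω : Set (Sym2 V) => P ∈ openCluster (ω ∩ (E₁ ∪ E₂)) s),
      K₁ (openCluster (ω ∩ (E₁ ∪ E₂)) s) (openCluster (ωᶜ ∩ (E₁ ∪ E₂)) s) *
        K₂ (openCluster (ω ∩ (E₁ ∪ E₂)) s) (openCluster (ωᶜ ∩ (E₁ ∪ E₂)) s) := by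
  have hfilter : Finset.univ.filter (fun ω : Set (Sym2 V) => P ∈ openCluster (ω ∩ (E₁ ∪ E₂)) s) =
      Finset.univ.filter (fun ω : Set (Sym2 V) =>
        c ∈ openCluster (ω ∩ E₁) s ∧ P ∈ openCluster (ω ∩ E₂) c) :=
    Finset.filter_congr fun ω _ => far_event_iff hsep hs hPs hPE ω
  rw [hfilter]
  refine event_sum_nonneg_of_near_boxes hsep hs hdis (fun ω => c ∈ openCluster (ω ∩ E₁) s) ?_ Fix N hcover hinside huniq
    hdom (fun ω => P ∈ openCluster (ω ∩ E₂) c) ?_ hplus K₁ K₂ hK₁ hso₁ hK₂ hso₂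
  · intro ω ω' h
    show c ∈ openCluster (ω ∩ E₁) s ↔ c ∈ openCluster (ω' ∩ E₁) s
    rw [h]
  · intro ω ω' h
    show P ∈ openCluster (ω ∩ E₂) c ↔ P ∈ openCluster (ω' ∩ E₂) c
    rw [h]

end Series

end Antithetic

end Summit.CriticalPhenomena.PercolationContinuityZ3.Theorems
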